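import Literature.Algebra.Module.CharpolyTwoFibres
import Literature.AlgebraicGeometry.Motives.GoodReductionZeroSection
import Literature.AlgebraicGeometry.Motives.AbelianVarietyGoodReductionCotangentLattice
import HarnessLib

/-!
# The cotangent characteristic polynomial of an endomorphism of an abelian variety with good reduction is ONE monic
# polynomial over `𝓞_{k,𝔓}`, read in both fibres

Topic `Literature/AlgebraicGeometry/Motives`; namespace `Literature.AlgebraicGeometry.Motives.AbelianVariety.GoodReductionAt`.
THEOREMS only (net debt 0).  Cell `hodgecm-mathlib`, E2 line (height-one road for `shimuraTaniyamaPair_degOne'`),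
piece **P1-char** of A-p02's P1-SPEC — the text of `stub_P1char` VERBATIM — assembled (β2, A-p11) from
(α) A-p09 `GoodReductionZeroSection` (the zero section `e` of the smooth proper model `R.model` over `𝓞_{k,𝔓}`, its
generic point = origin of `A`, its special point = origin of `Ã = R.reduction` (origin pin), `e ≫ liftEnd u = e`),
(β1) A-p03 (the conormal module `M = I/I²` of `e` in an affine chart, with BOTH fibre identifications
`k ⊗ M ≃ T_0^*(A)`, `κ(𝔓) ⊗ M ≃ T_0^*(Ã)` intertwining the conormal action of `liftEnd u` with `cotangentMap A u` /
`cotangentMap Ã (redEnd u)`), and (β2) `Algebra/Module/CharpolyTwoFibres` + `FreeOfFibreRankEq` (`M` is FREE of rank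
`g = dim A = dim Ã` because both fibre ranks are `g` — no flatness used — so `char(γ | M) ∈ 𝓞_{k,𝔓}[X]` maps to both
cotangent characteristic polynomials).

THE PRINT.  [Shimura1998] §12.4 Prop. 26 (proof p. 109) and §13.1 (proof of Thm. 1, p. 129–130): the characteristic
polynomial of `ι(a)` on the cotangent space («the representation of `ι(a)` on the space of invariant differential
forms») of `A` has coefficients in `𝓞_{k,𝔓}` and reduces modulo `𝔓` to that of the reduction `ι̃(a)` on `Ã`.
Banked E2 leaf, NO floor change; HC_CM is proved only modulo the 7 printed citations until rung 0 closes.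

## References
* G. Shimura, *Abelian Varieties with Complex Multiplication and Modular Functions* (1998), §12.4 Prop. 26 (proof
  p. 109), §13.1 Thm. 1 (proof pp. 129–130). [cite: Shimura1998, §12.4 Prop. 26 (proof p. 109) and §13.1 Thm. 1]
* U. Görtz, T. Wedhorn, *Algebraic Geometry II* (2023), Remark 17.14, Remark 17.15 (1). [cite: GortzWedhorn2023, Remark 17.14 and Remark 17.15 (1)]
-/

noncomputable section

open CategoryTheory AlgebraicGeometry IsDedekindDomain NumberField Polynomial TensorProduct
open scoped NumberField

namespace Literature.AlgebraicGeometry.Motives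

namespace AbelianVariety

namespace GoodReductionAt

open Literature.Algebra.Module

/-- **P1-char (Shimura's specialisation of the cotangent characteristic polynomial).**  For an abelian variety `A`
over a number field `k` with a good-reduction datum `R` at `𝔓` and `u ∈ End A`, there is a MONIC
`P ∈ 𝓞_{k,𝔓}[X]` with `P mod 𝔓 = char(cotangentMap Ã (redEnd u))` over `κ(𝔓)` and `P = char(cotangentMap A u)` over
`k` (through `𝓞_{k,𝔓} ⊆ k`).  This is the text of `stub_P1char` of the E2 P1-skeleton.
[cite: Shimura1998, §12.4 Prop. 26 (proof p. 109) and §13.1 Thm. 1] -/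
theorem exists_monic_map_eq_charpoly_cotangentMap (k : Type) [Field k] [NumberField k] (A : AbelianVariety k)
    (𝔓 : HeightOneSpectrum (𝓞 k)) (R : A.GoodReductionAt 𝔓) (u : End A) :
    ∃ P : Polynomial (HeightOneSpectrum.valuationSubringAtPrime k 𝔓), P.Monic ∧
      P.map (residueAt 𝔓) = (cotangentMap R.reduction (R.redEnd u : R.reduction ⟶ R.reduction)).charpoly ∧
      P.map (HeightOneSpectrum.valuationSubringAtPrime k 𝔓).subtype = (cotangentMap A (u : A ⟶ A)).charpoly := by
  letI : Algebra (HeightOneSpectrum.valuationSubringAtPrime k 𝔓) 𝔓.asIdeal.ResidueField := (residueAt 𝔓).toAlgebra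
  -- (α) the zero section of the model, its special point (origin pin) and its `liftEnd`-invariance
  obtain ⟨e, he, hgen⟩ := R.exists_zeroSection
  have hsp := R.unitPt_reduction_comp_eq e he hgen
  have hev := R.zeroSection_comp_liftEnd_left e he hgen u
  -- (β1) the conormal lattice with both fibre identifications
  obtain ⟨M, _, _, _, γ, Φ, Ψ, h₁, h₂⟩ := R.exists_cotangentLattice_conj u e he hgen hsp hev
  -- (β2) both fibres have dimension `g`, so `M` is free and `char(γ | M)` specialises to both
  have hdim : Module.finrank 𝔓.asIdeal.ResidueField (Cotangent R.reduction) ≤ Module.finrank k (Cotangent A) := by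
    rw [finrank_cotangent, finrank_cotangent, R.dim_reduction]
  obtain ⟨P, hP, hP₂, hP₁⟩ := exists_monic_map_eq_charpoly_of_eq_conj
    (HeightOneSpectrum.valuationSubringAtPrime k 𝔓) k 𝔓.asIdeal.ResidueField M (residueAt_surjective 𝔓)
    γ Φ _ h₁ Ψ _ h₂ hdim
  exact ⟨P, hP, hP₂, hP₁⟩

/-- The degree of the polynomial of `exists_monic_map_eq_charpoly_cotangentMap` is `g = dim A` (read on the `k`-side:
`deg char(cotangentMap A u) = dim T_0^*(A) = dim A`). [cite: Shimura1998, §12.4 Prop. 26 (proof p. 109) and §13.1 Thm. 1] -/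
theorem exists_monic_natDegree_map_eq_charpoly_cotangentMap (k : Type) [Field k] [NumberField k]
    (A : AbelianVariety k) (𝔓 : HeightOneSpectrum (𝓞 k)) (R : A.GoodReductionAt 𝔓) (u : End A) :
    ∃ P : Polynomial (HeightOneSpectrum.valuationSubringAtPrime k 𝔓), P.Monic ∧ P.natDegree = A.dim ∧
      P.map (residueAt 𝔓) = (cotangentMap R.reduction (R.redEnd u : R.reduction ⟶ R.reduction)).charpoly ∧
      P.map (HeightOneSpectrum.valuationSubringAtPrime k 𝔓).subtype = (cotangentMap A (u : A ⟶ A)).charpoly := by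
  obtain ⟨P, hP, hP₂, hP₁⟩ := exists_monic_map_eq_charpoly_cotangentMap k A 𝔓 R u
  refine ⟨P, hP, ?_, hP₂, hP₁⟩
  have h := congrArg Polynomial.natDegree hP₁
  rw [hP.natDegree_map, LinearMap.charpoly_natDegree, finrank_cotangent] at h
  exact h

end GoodReductionAt

end AbelianVariety

end Literature.AlgebraicGeometry.Motives

end
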